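import Summits.Ventures.PackingBounds.Configurations.D4NotUniversallyOptimal
import Summits.Ventures.PackingBounds.Configurations.DesignSlackness
import Summits.Ventures.PackingBounds.Energy.ChebyshevUExplicit

/-!
# A universally optimal 24-point configuration on `S³` would have to be a spherical 5-design

Framing: lottery ticket; floor = certified bounds/negative ranges. Venture `PackingBounds` (cell
`pub-packcert`, seat `pub-packcert-energy`) — companion of `D4NotUniversallyOptimal.lean` and `HexagonDesigns.lean`.

Cohn–Conway–Elkies–Kumar (2007, §1): "We further conjecture that there is no universally optimal spherical code of
24 points in `S³`. Any such code would have to be a 5-design, because `C_{D₄}` is." This file proves the second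
sentence unconditionally: the `(1+t)⁵`-energy of `24` unit vectors of `ℝ⁴` is
`1608 + Σ_{j=1}^{5} w_j M_j` with the total Gegenbauer moments `M_j = Σ_{x,y} C_j^{(1)}(⟨x,y⟩) ≥ 0` and
`w = (165/32, 55/16, 11/8, 5/16, 1/32) > 0` (`ckPow_five_energy_eq`, `moment_nonneg`), so `E_{(1+t)⁵} ≥ 1608` with
equality exactly for 5-designs (`ckPow_five_energy_ge`, `design5_of_ckPow_five_le`); the `D₄` root system attains
`1608` (`Config.D4.energy_pts`), hence a universally optimal 24-point configuration is a 5-design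
(`design5_of_universallyOptimal`, with the per-point form). Together with `HexagonDesigns.lean` (a three-parameter
family of such 5-designs through `D₄`, inside which `D₄` is not universally optimal) this is the formal content of
CCEK's reduction of their conjecture to "every 24-point 5-design on `S³` lies in the hexagon family".

## References
* H. Cohn, J. H. Conway, N. D. Elkies, A. Kumar, *The D₄ root system is not universally optimal*,
  Experiment. Math. 16 (2007) 313–320, §1 and §4. [`CohnConwayElkiesKumar2007`]
-/

noncomputable section

namespace Summit.Ventures.PackingBounds.Config

open Finset Literature.Analysis.SpecialFunctions Summit.Ventures.PackingBounds.Energy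

/-- **Total Gegenbauer moments are nonnegative**: for unit vectors `C ⊂ ℝⁿ` (`n = 2μ + 2`, `μ > 0`),
`Σ_{x,y ∈ C} C_k^{(μ)}(⟨x,y⟩) ≥ 0` (positive semidefiniteness of the zonal kernels; tree:
`sum_mul_gegenbauerHom_nonneg`). [folklore] -/
theorem moment_nonneg {n : ℕ} {μ : ℝ} (hn : (n : ℝ) = 2 * μ + 2) (hμ : 0 < μ)
    (C : Finset (EuclideanSpace ℝ (Fin n))) (h1 : ∀ x ∈ C, ‖x‖ = 1) (k : ℕ) :
    0 ≤ ∑ x ∈ C, ∑ y ∈ C, gegenbauerSum μ k (inner ℝ x y) := by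
  classical
  have hpos := sum_mul_gegenbauerHom_nonneg (n := n) (μ := μ) hn hμ k
    (fun a : C => fun j => (a : EuclideanSpace ℝ (Fin n)) j) (fun _ => 1)
  have hunit : ∀ a : C, ∑ j, (a : EuclideanSpace ℝ (Fin n)) j ^ 2 = 1 := fun a => by
    rw [← EuclideanSpace.real_norm_sq_eq, h1 a a.2, one_pow]
  have hinner : ∀ a b : C, inner ℝ (a : EuclideanSpace ℝ (Fin n)) b =
      ∑ j, (a : EuclideanSpace ℝ (Fin n)) j * (b : EuclideanSpace ℝ (Fin n)) j := fun a b => by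
    simp [PiLp.inner_apply, mul_comm]
  simp only [hunit, mul_one, one_mul] at hpos
  rw [← Finset.sum_coe_sort C]
  simp_rw [← Finset.sum_coe_sort C]
  simpa only [hinner, gegenbauerSum_eq_gegenbauerHom] using hpos

/-- **The `(1+t)⁵`-energy of unit vectors of `ℝ⁴` in terms of the total Gegenbauer (`C^{(1)} = U`) moments**:
`Σ_{x ≠ y} (1+⟨x,y⟩)⁵ = (33/8)|C|² - 32|C| + (165/32)M₁ + (55/16)M₂ + (11/8)M₃ + (5/16)M₄ + (1/32)M₅`. [folklore] -/
theorem ckPow_five_energy_eq (C : Finset (EuclideanSpace ℝ (Fin 4))) (h1 : ∀ x ∈ C, ‖x‖ = 1) :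
    ∑ x ∈ C, ∑ y ∈ C.erase x, (1 + inner ℝ x y) ^ 5 =
      (33 / 8 : ℝ) * (C.card : ℝ) ^ 2 - 32 * C.card +
        (165 / 32 : ℝ) * ∑ x ∈ C, ∑ y ∈ C, gegenbauerSum 1 1 (inner ℝ x y) +
        (55 / 16 : ℝ) * ∑ x ∈ C, ∑ y ∈ C, gegenbauerSum 1 2 (inner ℝ x y) +
        (11 / 8 : ℝ) * ∑ x ∈ C, ∑ y ∈ C, gegenbauerSum 1 3 (inner ℝ x y) +
        (5 / 16 : ℝ) * ∑ x ∈ C, ∑ y ∈ C, gegenbauerSum 1 4 (inner ℝ x y) +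
        (1 / 32 : ℝ) * ∑ x ∈ C, ∑ y ∈ C, gegenbauerSum 1 5 (inner ℝ x y) := by
  classical
  have hdiag : ∀ x ∈ C, ∑ y ∈ C.erase x, (1 + inner ℝ x y) ^ 5 =
      ∑ y ∈ C, (1 + inner ℝ x y) ^ 5 - 32 := by
    intro x hx
    rw [← Finset.sum_erase_add _ _ hx, real_inner_self_eq_norm_sq, h1 x hx]
    norm_num
  rw [Finset.sum_congr rfl hdiag, Finset.sum_sub_distrib, sum_const, nsmul_eq_mul]
  have hlin : ∀ x y : EuclideanSpace ℝ (Fin 4), (1 + inner ℝ x y) ^ 5 =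
      (33 / 8 : ℝ) * gegenbauerSum 1 0 (inner ℝ x y) + (165 / 32 : ℝ) * gegenbauerSum 1 1 (inner ℝ x y) +
        (55 / 16 : ℝ) * gegenbauerSum 1 2 (inner ℝ x y) + (11 / 8 : ℝ) * gegenbauerSum 1 3 (inner ℝ x y) +
        (5 / 16 : ℝ) * gegenbauerSum 1 4 (inner ℝ x y) + (1 / 32 : ℝ) * gegenbauerSum 1 5 (inner ℝ x y) := by
    intro x y
    rw [ChebyshevU.c1_0, ChebyshevU.c1_1, ChebyshevU.c1_2, ChebyshevU.c1_3, ChebyshevU.c1_4,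
      ChebyshevU.c1_5]
    ring
  have hM0 : ∑ x ∈ C, ∑ y ∈ C, gegenbauerSum 1 0 (inner ℝ x y) = (C.card : ℝ) ^ 2 := by
    simp only [ChebyshevU.c1_0, sum_const, nsmul_eq_mul, mul_one]; ring
  simp_rw [hlin, Finset.sum_add_distrib, ← Finset.mul_sum, hM0]
  ring

/-- **LP bound with equality case for `(1+t)⁵` and `24` points on `S³`**: `Σ_{x ≠ y} (1+⟨x,y⟩)⁵ ≥ 1608`. [folklore] -/
theorem ckPow_five_energy_ge (C : Finset (EuclideanSpace ℝ (Fin 4))) (h1 : ∀ x ∈ C, ‖x‖ = 1)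
    (hN : C.card = 24) : (1608 : ℝ) ≤ ∑ x ∈ C, ∑ y ∈ C.erase x, (1 + inner ℝ x y) ^ 5 := by
  rw [ckPow_five_energy_eq C h1, hN]
  have h4 : ((4 : ℕ) : ℝ) = 2 * 1 + 2 := by norm_num
  have m1 := moment_nonneg h4 one_pos C h1 1
  have m2 := moment_nonneg h4 one_pos C h1 2
  have m3 := moment_nonneg h4 one_pos C h1 3
  have m4 := moment_nonneg h4 one_pos C h1 4
  have m5 := moment_nonneg h4 one_pos C h1 5
  push_cast
  nlinarith

/-- **Equality forces a 5-design**: a `24`-point configuration on `S³` with `(1+t)⁵`-energy `≤ 1608` (the value of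
the `D₄` root system and of every 24-point 5-design) has vanishing total Gegenbauer moments of orders `1, …, 5`. -/
theorem design5_of_ckPow_five_le (C : Finset (EuclideanSpace ℝ (Fin 4))) (h1 : ∀ x ∈ C, ‖x‖ = 1)
    (hN : C.card = 24) (hle : ∑ x ∈ C, ∑ y ∈ C.erase x, (1 + inner ℝ x y) ^ 5 ≤ 1608)
    (k : ℕ) (hk1 : 1 ≤ k) (hk5 : k ≤ 5) :
    ∑ x ∈ C, ∑ y ∈ C, gegenbauerSum 1 k (inner ℝ x y) = 0 := by
  rw [ckPow_five_energy_eq C h1, hN] at hle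
  have h4 : ((4 : ℕ) : ℝ) = 2 * 1 + 2 := by norm_num
  have m1 := moment_nonneg h4 one_pos C h1 1
  have m2 := moment_nonneg h4 one_pos C h1 2
  have m3 := moment_nonneg h4 one_pos C h1 3
  have m4 := moment_nonneg h4 one_pos C h1 4
  have m5 := moment_nonneg h4 one_pos C h1 5
  push_cast at hle
  interval_cases k <;> linarith

/-- **A universally optimal 24-point configuration on `S³` is a spherical 5-design** (Cohn–Conway–Elkies–Kumar 2007,
§1: "Any such code would have to be a 5-design, because `C_{D₄}` is"): if `C₀` (24 unit vectors of `ℝ⁴`) has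
`a`-energy at most that of every 24-point configuration for every `a` absolutely monotonic on `[-1,1)`, then
`Σ_{x,y ∈ C₀} C_k^{(1)}(⟨x,y⟩) = 0` for `k = 1, …, 5`, and hence `Σ_{y ∈ C₀} C_k^{(1)}(⟨x,y⟩) = 0` around every point.
[cite: CohnConwayElkiesKumar2007, §1 (a universally optimal 24-point code must be a 5-design)] -/
theorem design5_of_universallyOptimal (C₀ : Finset (EuclideanSpace ℝ (Fin 4))) (h1 : ∀ x ∈ C₀, ‖x‖ = 1)
    (hN : C₀.card = 24)
    (hopt : ∀ a : ℝ → ℝ, AbsolutelyMonotoneOn a (Set.Ico (-1) 1) →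
      ∀ C : Finset (EuclideanSpace ℝ (Fin 4)), (∀ x ∈ C, ‖x‖ = 1) → C.card = 24 →
        ∑ x ∈ C₀, ∑ y ∈ C₀.erase x, a (inner ℝ x y) ≤ ∑ x ∈ C, ∑ y ∈ C.erase x, a (inner ℝ x y))
    (k : ℕ) (hk1 : 1 ≤ k) (hk5 : k ≤ 5) :
    ∑ x ∈ C₀, ∑ y ∈ C₀, gegenbauerSum 1 k (inner ℝ x y) = 0 ∧
      ∀ x ∈ C₀, ∑ y ∈ C₀, gegenbauerSum 1 k (inner ℝ x y) = 0 := by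
  have h5 := hopt (fun t => (1 + t) ^ 5) (absolutelyMonotoneOn_one_add_pow 5) D4.pts D4.norm_of_mem_pts
    D4.card_pts
  have hD4 := D4.energy_pts (fun t => (1 + t) ^ 5)
  beta_reduce at hD4
  rw [hD4] at h5
  norm_num at h5
  have htot := design5_of_ckPow_five_le C₀ h1 hN h5 k hk1 hk5
  exact ⟨htot, fun x hx => DesignSlackness.pointMoment_eq_zero_of_total (n := 4) (μ := 1) (by norm_num)
    one_pos C₀ h1 k htot hx⟩

end Summit.Ventures.PackingBounds.Config

end
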